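import Mathlib
import Summits.Ventures.PercRepro2.HCov
import Summits.Ventures.PercRepro2.A3FibreA
import Summits.Ventures.PercRepro2.A3RootEdgeAll
import Summits.Ventures.PercRepro2.A3BetweenSwap
import Summits.Ventures.PercRepro2.EdgeCubic
import Summits.Ventures.PercRepro2.OEdgeCubic

/-!
# The conditional class reduction to graphs in which `a₃` has no edge to a root or to `o`
(blind cell PercRepro2, p5 g14; `proofs/P5-OEDGE.md` §6)

`IsRootOrOEdge`: `e` joins `a₃` to `a₁`, `a₂` or `o`.  Under the hypothesis **`OEdgeBern_all`** —
the two Bernstein coefficients `B1`, `B2` of `Gc` are nonnegative at every edge `e = {a₃, o}` of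
every finite graph and admissible weight vector (the t-free inequalities `P1, P2 ≥ 0` of
P5-OEDGE.md §2, census 1,993,333 / 0 / 0 / 0, no proof) — the root-edge closure
(`HCov_of_update_zero_of_isRootEdge`, A3RootEdgeAll) and the o-edge closure
(`HCov_of_update_zero_of_bern_o`, OEdgeCubic) compose: `HCov_of_zeroOn_rootOEdges` deletes any
finset of such edges, `HCov_of_noRootOEdge_class` reduces (HCOV) at `p` to the weight vectors in
which `a₃` has no edge to `a₁`, `a₂` or `o`, and **`HCov_all_iff_noRootOEdge_all`**: the crux is
equivalent to its restriction to that class.  Every statement here is CONDITIONAL on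
`OEdgeBern_all`; the unconditional root-edge half is `HCov_all_iff_noRootEdge_all`.
-/

namespace Summit.Ventures.PercRepro2

open UnionCluster

namespace CovForm

namespace OEdge

open EdgeLine RootEdge A3Fibre

section Both

variable {V : Type*} {E : Type*} [Fintype V] [DecidableEq V] [Fintype E] [DecidableEq E]
  {R : Type*} [Field R] [LinearOrder R] [IsStrictOrderedRing R]

/-- `e` joins `a₃` to a root or to `o` (either orientation). -/
def IsRootOrOEdge (ends : E → Sym2 V) (o a₁ a₂ a₃ : V) (e : E) : Prop :=
  IsRootEdge ends a₁ a₂ a₃ e ∨ ends e = s(a₃, o) ∨ ends e = s(o, a₃)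

/-- The Bernstein hypothesis at the o-edges of one instance: `0 ≤ B1` and `0 ≤ B2` at every edge
`{a₃, o}` for every admissible weight vector on the same graph. -/
def OEdgeBern (ends : E → Sym2 V) (o a₁ a₂ a₃ b : V) : Prop :=
  ∀ (p : E → R), IsProbVec p → ∀ e, ends e = s(a₃, o) →
    0 ≤ B1 p ends o a₁ a₂ a₃ b e ∧ 0 ≤ B2 p ends o a₁ a₂ a₃ b e

/-- The closure at any root edge or o-edge at `a₃`, under `OEdgeBern`. -/
theorem HCov_of_update_zero_of_isRootOrOEdge (p : E → R) (hp : IsProbVec p) (ends : E → Sym2 V)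
    (o a₁ a₂ a₃ b : V) (hB : OEdgeBern (R := R) ends o a₁ a₂ a₃ b) (e : E)
    (he : IsRootOrOEdge ends o a₁ a₂ a₃ e)
    (h₀ : HCov (Function.update p e 0) ends o a₁ a₂ a₃ b) : HCov p ends o a₁ a₂ a₃ b := by
  rcases he with h | h | h
  · exact HCov_of_update_zero_of_isRootEdge p hp ends o a₁ a₂ a₃ b e h h₀
  · exact HCov_of_update_zero_of_bern_o p hp ends o a₁ a₂ a₃ b e h h₀ (hB p hp e h).1 (hB p hp e h).2
  · have h' : ends e = s(a₃, o) := by rw [h, Sym2.eq_swap]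
    exact HCov_of_update_zero_of_bern_o p hp ends o a₁ a₂ a₃ b e h' h₀ (hB p hp e h').1
      (hB p hp e h').2

/-- **Deleting any set of root edges and o-edges at `a₃`** under `OEdgeBern`:
`HCov (zeroOn p T) → HCov p`. -/
theorem HCov_of_zeroOn_rootOEdges (p : E → R) (hp : IsProbVec p) (ends : E → Sym2 V)
    (o a₁ a₂ a₃ b : V) (hB : OEdgeBern (R := R) ends o a₁ a₂ a₃ b) (T : Finset E)
    (hT : ∀ e ∈ T, IsRootOrOEdge ends o a₁ a₂ a₃ e)
    (h₀ : HCov (zeroOn p T) ends o a₁ a₂ a₃ b) : HCov p ends o a₁ a₂ a₃ b := by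
  induction T using Finset.induction_on generalizing p with
  | empty => simpa only [zeroOn_empty] using h₀
  | insert e T _ ih =>
    have hp₀ : IsProbVec (Function.update p e 0) := hp.update e le_rfl zero_le_one
    refine HCov_of_update_zero_of_isRootOrOEdge p hp ends o a₁ a₂ a₃ b hB e
      (hT e (Finset.mem_insert_self e T)) ?_
    refine ih (Function.update p e 0) hp₀ (fun e' he' => hT e' (Finset.mem_insert_of_mem he')) ?_
    rw [zeroOn_update_zero_comm, ← zeroOn_insert]
    exact h₀

/-- `a₃` HAS NO EDGE TO A ROOT OR TO `o`: every such edge has weight `0`. -/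
def NoRootOrOEdge (p : E → R) (ends : E → Sym2 V) (o a₁ a₂ a₃ : V) : Prop :=
  ∀ e, IsRootOrOEdge ends o a₁ a₂ a₃ e → p e = 0

omit [Fintype V] [DecidableEq V] [LinearOrder R] [IsStrictOrderedRing R] in
/-- The instance with every root edge and o-edge at `a₃` deleted has none. -/
lemma noRootOrOEdge_zeroOn_filter (p : E → R) (ends : E → Sym2 V) (o a₁ a₂ a₃ : V)
    [DecidablePred (IsRootOrOEdge ends o a₁ a₂ a₃)] :
    NoRootOrOEdge (zeroOn p (Finset.univ.filter (IsRootOrOEdge ends o a₁ a₂ a₃))) ends o a₁ a₂ a₃ := by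
  intro e he
  simp only [zeroOn, Finset.mem_filter, Finset.mem_univ, true_and, he, if_true]

/-- **(HCOV) from the class `NoRootOrOEdge`** under `OEdgeBern`: if (HCOV) holds for every
admissible weight vector on the same graph and marks in which `a₃` has no edge to a root or to `o`,
it holds at `p`. -/
theorem HCov_of_noRootOEdge_class (p : E → R) (hp : IsProbVec p) (ends : E → Sym2 V)
    (o a₁ a₂ a₃ b : V) (hB : OEdgeBern (R := R) ends o a₁ a₂ a₃ b)
    (h : ∀ p' : E → R, IsProbVec p' → NoRootOrOEdge p' ends o a₁ a₂ a₃ → HCov p' ends o a₁ a₂ a₃ b) :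
    HCov p ends o a₁ a₂ a₃ b := by
  classical
  refine HCov_of_zeroOn_rootOEdges p hp ends o a₁ a₂ a₃ b hB
    (Finset.univ.filter (IsRootOrOEdge ends o a₁ a₂ a₃)) (fun e he => (Finset.mem_filter.1 he).2) ?_
  exact h _ (isProbVec_zeroOn hp _) (noRootOrOEdge_zeroOn_filter p ends o a₁ a₂ a₃)

end Both

section Closure

variable (R : Type*) [Field R] [LinearOrder R] [IsStrictOrderedRing R]

/-- **The Bernstein hypothesis at the o-edges of every finite graph** (the binders of `HCov_all`):
`0 ≤ B1` and `0 ≤ B2` at every edge `{a₃, o}` — the t-free inequalities `P1, P2 ≥ 0` of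
P5-OEDGE.md §2 in the tree's vocabulary (census-true, not proved). -/
def OEdgeBern_all : Prop :=
  ∀ (V E : Type) [Fintype V] [DecidableEq V] [Fintype E] [DecidableEq E]
    (ends : E → Sym2 V) (p : E → R), IsProbVec p →
    ∀ o a₁ a₂ a₃ b : V, a₁ ≠ a₂ → a₁ ≠ a₃ → a₂ ≠ a₃ → o ≠ a₁ → o ≠ a₂ → o ≠ a₃ → o ≠ b →
      b ≠ a₁ → b ≠ a₂ → b ≠ a₃ → ∀ e, ends e = s(a₃, o) →
        0 ≤ B1 p ends o a₁ a₂ a₃ b e ∧ 0 ≤ B2 p ends o a₁ a₂ a₃ b e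

/-- **(HCOV) on every finite graph in which `a₃` has no edge to a root or to `o`** (the binders of
`HCov_all` plus `NoRootOrOEdge`). -/
def HCovNoRootOEdge_all : Prop :=
  ∀ (V E : Type) [Fintype V] [DecidableEq V] [Fintype E] [DecidableEq E]
    (ends : E → Sym2 V) (p : E → R), IsProbVec p →
    ∀ o a₁ a₂ a₃ b : V, a₁ ≠ a₂ → a₁ ≠ a₃ → a₂ ≠ a₃ → o ≠ a₁ → o ≠ a₂ → o ≠ a₃ → o ≠ b →
      b ≠ a₁ → b ≠ a₂ → b ≠ a₃ → NoRootOrOEdge p ends o a₁ a₂ a₃ → HCov p ends o a₁ a₂ a₃ b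

/-- **Under `OEdgeBern_all`, the crux is equivalent to its restriction to graphs in which `a₃` has
no edge to a root or to `o`** (conditional; the unconditional root-edge half is
`HCov_all_iff_noRootEdge_all`). -/
theorem HCov_all_iff_noRootOEdge_all (hB : OEdgeBern_all R) :
    HCov_all R ↔ HCovNoRootOEdge_all R := by
  constructor
  · intro h V E _ _ _ _ ends p hp o a₁ a₂ a₃ b h1 h2 h3 h4 h5 h6 h7 h8 h9 h10 _
    exact h V E ends p hp o a₁ a₂ a₃ b h1 h2 h3 h4 h5 h6 h7 h8 h9 h10
  · intro h V E _ _ _ _ ends p hp o a₁ a₂ a₃ b h1 h2 h3 h4 h5 h6 h7 h8 h9 h10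
    have hB' : OEdgeBern (R := R) ends o a₁ a₂ a₃ b := fun p' hp' e he =>
      hB V E ends p' hp' o a₁ a₂ a₃ b h1 h2 h3 h4 h5 h6 h7 h8 h9 h10 e he
    exact HCov_of_noRootOEdge_class p hp ends o a₁ a₂ a₃ b hB' fun p' hp' hn =>
      h V E ends p' hp' o a₁ a₂ a₃ b h1 h2 h3 h4 h5 h6 h7 h8 h9 h10 hn

end Closure

end OEdge

end CovForm

end Summit.Ventures.PercRepro2
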